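/-
Copyright (c) 2026. All rights reserved.
Released under Apache 2.0 license as described in the file LICENSE.
-/
import Literature.AlgebraicGeometry.Pohlmann1968.AbelianCMFieldSurvivorClosureCriterion
import Literature.NumberTheory.ComplexMultiplication.CMTypeRankReflexDegreeComplex
import HarnessLib

/-!
# Ranks `4` and `5`: the reflex degree decides the exceptional Hodge classes of an abelian variety with complex
# multiplication by an ABELIAN CM field

SETTING.  `K` a CM field, `Φ` a CM type of `K`, `Rank(Φ) = cmTypeRank Φ`, `K* = ℚ(tr_Φ(K)) ⊂ ℂ` the reflex field
(tree `traceField`), `Stab(Φ)` the stabiliser (tree `twistStabilizer`).  Ribet's inequalities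
`⌈log₂ 2[K* : ℚ]⌉ ≤ Rank(Φ) ≤ [K* : ℚ]/2 + 1` and Dodson's prime constraints (`p ∣ [K* : ℚ]`, `p` odd prime ⟹
`p + 1 ≤ Rank`; `q² ∣ [K* : ℚ]` ⟹ `2q ≤ Rank`) are in the tree for every CM field ([Ribet1980] §3 (3.3)–(3.5),
[Dodson1987] Thm. 1.4 and 1.12; tree `CMTypeRankReflexDegreeComplex`), as is, for `K` ABELIAN, the reflex-degree
criterion `Bᵐ(A) ⊗ ℂ = Dᵐ(A) ⊗ ℂ ∀ m ⟺ [K* : ℚ] = 2·(Rank(Φ) − 1)` / exceptional class on `A ⟺ 2·(Rank − 1) < [K* : ℚ]`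
(tree `AbelianCMFieldSurvivorClosureCriterion`, g40-#2).  THIS FILE tabulates the two smallest ranks at which
exceptional classes can occur:

> **Theorem** (`finrank_traceField_eq_six_or_eight_of_cmTypeRank_eq_four`,
> `finrank_traceField_mem_of_cmTypeRank_eq_five`; every CM field).  `Rank(Φ) = 4 ⟹ [K* : ℚ] ∈ {6, 8}`;
> `Rank(Φ) = 5 ⟹ [K* : ℚ] ∈ {8, 12, 16}`.
> **Theorem** (abelian `K`, any `A` of type `(K; Φ)`).  `Rank(Φ) = 4`: `A` carries an exceptional Hodge class iff
> `[K* : ℚ] = 8`, and `Bᵐ(A) ⊗ ℂ = Dᵐ(A) ⊗ ℂ` for all `m` (indeed the Hodge conjecture for all powers) iff `[K* : ℚ] = 6`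
> (`exists_exceptional_iff_finrank_traceField_eq_eight_of_cmTypeRank_eq_four`,
> `hodgeConjectureFor_pow_of_cmTypeRank_eq_four_of_finrank_traceField_eq_six`).  `Rank(Φ) = 5`: exceptional iff
> `[K* : ℚ] ∈ {12, 16}`, `B = D` (and the Hodge conjecture for all powers) iff `[K* : ℚ] = 8`.
> **Theorem** (abelian `K`, reflex degree `8`: `Rank ∈ {4, 5}`).  `A` carries an exceptional Hodge class iff
> `Rank(Φ) = 4`; the Hodge conjecture holds for all powers of `A` iff … whenever `Rank(Φ) = 5`
> (`exists_exceptional_iff_cmTypeRank_eq_four_of_finrank_traceField_eq_eight`,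
> `hodgeConjectureFor_pow_of_finrank_traceField_eq_eight_of_cmTypeRank_eq_five`); reflex degree `6` ⟹ the Hodge
> conjecture for all powers (`hodgeConjectureFor_pow_of_finrank_traceField_eq_six`).

(Ranks `2` and `3` never carry exceptional classes, over any CM field: tree `CMTypeRankTwo`, `CMTypeRankThree`.)

* §1 (abelian `K`, realisation-free) **`two_mul_natCard_twistStabilizer_mul_eq_iff_finrank_traceField_eq`**
  (`2|Stab(Φ)|(Rank − 1) = [K:ℚ] ⟺ [K* : ℚ] = 2(Rank − 1)`), `two_mul_natCard_twistStabilizer_mul_lt_iff_lt_finrank_traceField`,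
  **`hodgeClassSpan_pow_eq_divisorClassesSpan_of_finrank_traceField_eq`**, **`hodgeConjectureFor_pow_of_finrank_traceField_eq`**
  (`[K* : ℚ] = 2(Rank − 1) ⟹` Hodge conjecture for every power), `exists_exceptional_pow_iff_lt_finrank_traceField`.
* §2 (every CM field) **`finrank_traceField_eq_six_or_eight_of_cmTypeRank_eq_four`**,
  **`finrank_traceField_mem_of_cmTypeRank_eq_five`**.
* §3 (abelian `K`) rank `4`: `forall_hodgeClassSpan_eq_iff_finrank_traceField_eq_six_of_cmTypeRank_eq_four`,
  **`exists_exceptional_iff_finrank_traceField_eq_eight_of_cmTypeRank_eq_four`**,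
  `hodgeConjectureFor_pow_of_cmTypeRank_eq_four_of_finrank_traceField_eq_six`; rank `5`:
  `forall_hodgeClassSpan_eq_iff_finrank_traceField_eq_eight_of_cmTypeRank_eq_five`,
  **`exists_exceptional_iff_finrank_traceField_mem_of_cmTypeRank_eq_five`**,
  `hodgeConjectureFor_pow_of_cmTypeRank_eq_five_of_finrank_traceField_eq_eight`.
* §4 (abelian `K`) by reflex degree: **`hodgeConjectureFor_pow_of_finrank_traceField_eq_six`**,
  **`exists_exceptional_iff_cmTypeRank_eq_four_of_finrank_traceField_eq_eight`**,
  `forall_hodgeClassSpan_eq_iff_cmTypeRank_eq_five_of_finrank_traceField_eq_eight`,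
  `hodgeConjectureFor_pow_of_finrank_traceField_eq_eight_of_cmTypeRank_eq_five`.

HONEST SCOPE.  Arithmetic on tree theorems; abelian `K` for everything involving Hodge classes.  The sources print the
inequalities (Ribet, Dodson) and tables of `(n*, rank)` (Dodson 1987 §§1–3); the «exceptional iff `[K* : ℚ] = 8`»
lines are this file's packaging of Gordon's Thm. 6.4 / White's Thm. 3 through the reflex-degree criterion, not numbered
statements of the sources.  THEOREMS ONLY: no definition, no named fact, no instance, no `sorry`.

## References

* [Ribet1980] K. A. Ribet, *Division fields of abelian varieties with complex multiplication*, Mém. SMF 2 (1980),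
  §3 Prop. (3.3), (3.4)–(3.5) (pp. 86–87).
* [Dodson1987] B. Dodson, *On the Mumford–Tate group of an abelian variety with complex multiplication*, J. Algebra
  111 (1987), Thm. 1.0, Thm. 1.4, Thm. 1.12.
* [Gordon1999HodgeAVSurvey] B. B. Gordon, *A survey of the Hodge conjecture for abelian varieties*, Thm. 6.4, §9.2–9.3.
* [White1993SporadicCycles] S. P. White, *Sporadic cycles on CM abelian varieties*, Compositio Math. 88 (1993), §4 Thm. 3.
* [Shimura1998] G. Shimura, *Abelian Varieties with Complex Multiplication and Modular Functions*, §8.4 Example (1),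
  §32.10.
* [Pohlmann1968] H. Pohlmann, *Algebraic cycles on abelian varieties of complex multiplication type*, Ann. of Math. 88
  (1968), Thm. 1, §3.

## Provenance

Lane `lit-hodgefound` (Track 2, Layer A5), seat `lit-hodgefound-p10` generation 40, row g40-#4; neighbours cited by
name, nothing restated: `AbelianCMFieldSurvivorClosureCriterion` (g40-#2: `forall_hodgeClassSpan_eq_iff_finrank_traceField_eq`,
`exists_exceptional_iff_lt_finrank_traceField`), `AbelianCMFieldStabilizerExceptionalClasses` (g39-#9),
`CMTypeRankStabilizerBound` (g39-#7: `hodgeClassSpan_pow_eq_divisorClassesSpan_of_two_mul_natCard_twistStabilizer_mul_eq`,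
`hodgeConjectureFor_pow_of_two_mul_natCard_twistStabilizer_mul_eq`), `CMTypeGaloisClassReflexDegree`
(`card_twistStabilizer_mul_finrank_traceField`), `CMTypeRankReflexDegreeComplex` (Ribet's and Dodson's inequalities,
`cmTypeRank_eq_four_of_finrank_traceField_eq_six`, `cmTypeRank_mem_of_finrank_traceField_eq_eight`),
`NonSimpleCMAbelianVarietyHazamaCriterion` (`exists_exceptional_pow_iff_exists_exceptional`).
-/

open scoped BigOperators NumberField IsMulCommutative Classical
open NumberField Module CategoryTheory CategoryTheory.Limits IntermediateField

namespace Literature.AlgebraicGeometry.Pohlmann1968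

open scoped Literature.NumberTheory.ComplexMultiplication
open Literature.NumberTheory.ComplexMultiplication (twistStabilizer traceField card_twistStabilizer_mul_finrank_traceField
  cmTypeRank_le_finrank_traceField_div_two_add_one two_mul_finrank_traceField_le_two_pow_cmTypeRank
  add_one_le_cmTypeRank_of_prime_dvd_finrank_traceField two_mul_le_cmTypeRank_of_prime_sq_dvd_finrank_traceField
  cmTypeRank_eq_four_of_finrank_traceField_eq_six cmTypeRank_mem_of_finrank_traceField_eq_eight)
open Literature.AlgebraicGeometry.Motives (CMType AbelianVariety)
open Literature.AlgebraicGeometry.HodgeTheory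
open Literature.AlgebraicGeometry.VanGeemen1994 (hodgeClassSpan)
open Literature.Barriers.HodgeConjecture (divisorClassesSpan)
open Literature.AlgebraicGeometry.ComplexMultiplication (IsCMTypeRealisation)

variable {K : Type} [Field K] [NumberField K] [IsCMField K]
  {A : AbelianVariety ℂ} {ι : 𝓞 K →+* End A} {θ : K →+* Module.End ℂ (complexBetti A.X 1)}

/-! ## §1 Abelian `K`: the extremal condition in reflex degrees, realisation-free, and the Hodge conjecture for all powers -/

section ReflexForm

variable [IsAbelianGalois ℚ K]

omit [IsCMField K] in
/-- **`2·|Stab(Φ)|·(Rank(Φ) − 1) = [K:ℚ] ⟺ [K* : ℚ] = 2·(Rank(Φ) − 1)`** for an abelian CM field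
(`|Stab(Φ)|·[K* : ℚ] = [K:ℚ]`). [cite: Shimura1998, §8.4 Example (1) and §32.10] [cite: Ribet1980, §3 (3.4)] -/
theorem two_mul_natCard_twistStabilizer_mul_eq_iff_finrank_traceField_eq [IsCMField K] (Φ : CMType K) :
    2 * Nat.card (twistStabilizer Φ) * (cmTypeRank Φ - 1) = finrank ℚ K ↔
      finrank ℚ (traceField Φ) = 2 * (cmTypeRank Φ - 1) := by
  rw [← card_twistStabilizer_mul_finrank_traceField (fun a b => mul_comm a b) Φ]
  have hpos : 0 < Nat.card (twistStabilizer Φ) := Nat.card_pos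
  constructor
  · intro h
    apply Nat.eq_of_mul_eq_mul_left hpos
    calc Nat.card (twistStabilizer Φ) * finrank ℚ (traceField Φ)
        = 2 * Nat.card (twistStabilizer Φ) * (cmTypeRank Φ - 1) := h.symm
      _ = Nat.card (twistStabilizer Φ) * (2 * (cmTypeRank Φ - 1)) := by ring
  · intro h
    calc 2 * Nat.card (twistStabilizer Φ) * (cmTypeRank Φ - 1)
        = Nat.card (twistStabilizer Φ) * (2 * (cmTypeRank Φ - 1)) := by ring
      _ = Nat.card (twistStabilizer Φ) * finrank ℚ (traceField Φ) := by rw [h]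

omit [IsCMField K] in
/-- **`2·|Stab(Φ)|·(Rank(Φ) − 1) < [K:ℚ] ⟺ 2·(Rank(Φ) − 1) < [K* : ℚ]`** (abelian `K`). [cite: Shimura1998, §8.4 Example (1) and §32.10]
[cite: Ribet1980, §3 (3.4)] -/
theorem two_mul_natCard_twistStabilizer_mul_lt_iff_lt_finrank_traceField [IsCMField K] (Φ : CMType K) :
    2 * Nat.card (twistStabilizer Φ) * (cmTypeRank Φ - 1) < finrank ℚ K ↔
      2 * (cmTypeRank Φ - 1) < finrank ℚ (traceField Φ) := by
  rw [← card_twistStabilizer_mul_finrank_traceField (fun a b => mul_comm a b) Φ,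
    show 2 * Nat.card (twistStabilizer Φ) * (cmTypeRank Φ - 1) =
      Nat.card (twistStabilizer Φ) * (2 * (cmTypeRank Φ - 1)) by ring]
  have hpos : 0 < Nat.card (twistStabilizer Φ) := Nat.card_pos
  exact ⟨fun h => Nat.lt_of_mul_lt_mul_left h, fun h => Nat.mul_lt_mul_of_pos_left h hpos⟩

/-- **`[K* : ℚ] = 2·(Rank(Φ) − 1) ⟹ Bᵐ(Aⁿ) ⊗ ℂ = Dᵐ(Aⁿ) ⊗ ℂ` FOR ALL `n, m`** (abelian CM field, any type, any
realisation; the extremal case of the stabiliser bound, tree g39-#7). [cite: Gordon1999HodgeAVSurvey, Thm. 6.4 and §9.3]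
[cite: Shimura1998, §32.9–32.10] -/
theorem hodgeClassSpan_pow_eq_divisorClassesSpan_of_finrank_traceField_eq (Φ : CMType K)
    (h : finrank ℚ (traceField Φ) = 2 * (cmTypeRank Φ - 1)) (hA : IsCMTypeRealisation Φ A ι θ) (n m : ℕ) :
    hodgeClassSpan (⨁ fun _ : Fin n => A).dim (⨁ fun _ : Fin n => A).X m =
      divisorClassesSpan (⨁ fun _ : Fin n => A).X (⨁ fun _ : Fin n => A).dim m :=
  hodgeClassSpan_pow_eq_divisorClassesSpan_of_two_mul_natCard_twistStabilizer_mul_eq Φ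
    ((two_mul_natCard_twistStabilizer_mul_eq_iff_finrank_traceField_eq Φ).2 h) hA n m

/-- **`[K* : ℚ] = 2·(Rank(Φ) − 1) ⟹ THE HODGE CONJECTURE FOR EVERY POWER `Aⁿ`** (abelian CM field, any type, any
realisation). [cite: Gordon1999HodgeAVSurvey, Thm. 6.4 and §9.3] [cite: Shimura1998, §32.9–32.10] -/
theorem hodgeConjectureFor_pow_of_finrank_traceField_eq (Φ : CMType K)
    (h : finrank ℚ (traceField Φ) = 2 * (cmTypeRank Φ - 1)) (hA : IsCMTypeRealisation Φ A ι θ) (n : ℕ) :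
    HodgeConjectureFor (⨁ fun _ : Fin n => A).dim (⨁ fun _ : Fin n => A).X :=
  hodgeConjectureFor_pow_of_two_mul_natCard_twistStabilizer_mul_eq Φ
    ((two_mul_natCard_twistStabilizer_mul_eq_iff_finrank_traceField_eq Φ).2 h) hA n

/-- **Some power of `A` carries an exceptional Hodge class iff `2·(Rank(Φ) − 1) < [K* : ℚ]`** (iff `A` itself does,
abelian `K`). [cite: Gordon1999HodgeAVSurvey, Thm. 6.4 and §9.2] [cite: White1993SporadicCycles, §4 Theorem 3] -/
theorem exists_exceptional_pow_iff_lt_finrank_traceField (Φ : CMType K) (hA : IsCMTypeRealisation Φ A ι θ) :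
    (∃ n m : ℕ, ∃ c : complexBetti (⨁ fun _ : Fin n => A).X (2 * m), IsRationalClass c ∧
        IsOfHodgeType (⨁ fun _ : Fin n => A).dim (⨁ fun _ : Fin n => A).X (2 * m) m m c ∧
        c ∉ divisorClassesSpan (⨁ fun _ : Fin n => A).X (⨁ fun _ : Fin n => A).dim m) ↔
      2 * (cmTypeRank Φ - 1) < finrank ℚ (traceField Φ) := by
  rw [exists_exceptional_pow_iff_exists_exceptional hA, exists_exceptional_iff_lt_finrank_traceField Φ hA]

end ReflexForm

/-! ## §2 Every CM field: `Rank = 4 ⟹ [K* : ℚ] ∈ {6, 8}`, `Rank = 5 ⟹ [K* : ℚ] ∈ {8, 12, 16}` -/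

section Reflex

/-- **`Rank(Φ) = 4 ⟹ [K* : ℚ] = 6` or `8`** (every CM field): `6 ≤ [K* : ℚ] ≤ 8` by Ribet's squeeze, and `7 ∣ [K* : ℚ]`
would force `Rank ≥ 8` (Dodson). [cite: Ribet1980, §3 (3.4)–(3.5) (pp. 86–87)] [cite: Dodson1987, Thm. 1.0 and Thm. 1.4] -/
theorem finrank_traceField_eq_six_or_eight_of_cmTypeRank_eq_four (Φ : CMType K) (hr : cmTypeRank Φ = 4) :
    finrank ℚ (traceField Φ) = 6 ∨ finrank ℚ (traceField Φ) = 8 := by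
  have h1 := cmTypeRank_le_finrank_traceField_div_two_add_one Φ
  have h2 := two_mul_finrank_traceField_le_two_pow_cmTypeRank Φ
  rw [hr] at h1 h2
  norm_num at h2
  have h7 : finrank ℚ (traceField Φ) ≠ 7 := fun h7 => by
    have := add_one_le_cmTypeRank_of_prime_dvd_finrank_traceField Φ (by norm_num : Nat.Prime 7) (by norm_num)
      (by rw [h7])
    omega
  omega

/-- **`Rank(Φ) = 5 ⟹ [K* : ℚ] ∈ {8, 12, 16}`** (every CM field): `8 ≤ [K* : ℚ] ≤ 16` by Ribet's squeeze; `9` is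
excluded by `3² ∣ 9 ⟹ Rank ≥ 6`, `10` and `15` by `5 ∣ ⟹ Rank ≥ 6`, `11`, `13`, `14 = 2·7` by the primes `11, 13, 7`
(Dodson). [cite: Ribet1980, §3 (3.4)–(3.5) (pp. 86–87)] [cite: Dodson1987, Thm. 1.0, Thm. 1.4 and Thm. 1.12] -/
theorem finrank_traceField_mem_of_cmTypeRank_eq_five (Φ : CMType K) (hr : cmTypeRank Φ = 5) :
    finrank ℚ (traceField Φ) = 8 ∨ finrank ℚ (traceField Φ) = 12 ∨ finrank ℚ (traceField Φ) = 16 := by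
  have h1 := cmTypeRank_le_finrank_traceField_div_two_add_one Φ
  have h2 := two_mul_finrank_traceField_le_two_pow_cmTypeRank Φ
  rw [hr] at h1 h2
  norm_num at h2
  have hp : ∀ p : ℕ, p.Prime → p ≠ 2 → p ∣ finrank ℚ (traceField Φ) → p + 1 ≤ 5 := fun p hp hp2 hdvd => by
    have := add_one_le_cmTypeRank_of_prime_dvd_finrank_traceField Φ hp hp2 hdvd
    omega
  have h9 : finrank ℚ (traceField Φ) ≠ 9 := fun h9 => by
    have := two_mul_le_cmTypeRank_of_prime_sq_dvd_finrank_traceField Φ Nat.prime_three (by norm_num)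
      (by rw [h9]; norm_num)
    omega
  have h10 : finrank ℚ (traceField Φ) ≠ 10 := fun h =>
    absurd (hp 5 Nat.prime_five (by norm_num) (by rw [h]; norm_num)) (by norm_num)
  have h11 : finrank ℚ (traceField Φ) ≠ 11 := fun h =>
    absurd (hp 11 (by norm_num) (by norm_num) (by rw [h])) (by norm_num)
  have h13 : finrank ℚ (traceField Φ) ≠ 13 := fun h =>
    absurd (hp 13 (by norm_num) (by norm_num) (by rw [h])) (by norm_num)
  have h14 : finrank ℚ (traceField Φ) ≠ 14 := fun h =>
    absurd (hp 7 (by norm_num) (by norm_num) (by rw [h]; norm_num)) (by norm_num)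
  have h15 : finrank ℚ (traceField Φ) ≠ 15 := fun h =>
    absurd (hp 5 Nat.prime_five (by norm_num) (by rw [h]; norm_num)) (by norm_num)
  omega

end Reflex

/-! ## §3 Abelian `K`: ranks `4` and `5` -/

section RankFourFive

variable [IsAbelianGalois ℚ K]

/-- **Rank `4`, abelian `K`: `Bᵐ(A) ⊗ ℂ = Dᵐ(A) ⊗ ℂ` for all `m` iff `[K* : ℚ] = 6`.** [cite: Gordon1999HodgeAVSurvey, Thm. 6.4 and §9.2]
[cite: Ribet1980, §3 (3.4)–(3.5)] [cite: Dodson1987, Thm. 1.0] -/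
theorem forall_hodgeClassSpan_eq_iff_finrank_traceField_eq_six_of_cmTypeRank_eq_four (Φ : CMType K)
    (hr : cmTypeRank Φ = 4) (hA : IsCMTypeRealisation Φ A ι θ) :
    (∀ m : ℕ, hodgeClassSpan (finrank ℚ K / 2) A.X m = divisorClassesSpan A.X (finrank ℚ K / 2) m) ↔
      finrank ℚ (traceField Φ) = 6 := by
  rw [forall_hodgeClassSpan_eq_iff_finrank_traceField_eq Φ hA, hr]

/-- **RANK `4`, ABELIAN `K`: `A` CARRIES AN EXCEPTIONAL HODGE CLASS IFF `[K* : ℚ] = 8`** (the other possibility being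
`[K* : ℚ] = 6`, no exceptional classes on any power). [cite: Gordon1999HodgeAVSurvey, Thm. 6.4 and §9.2]
[cite: White1993SporadicCycles, §4 Theorem 3] [cite: Ribet1980, §3 (3.4)–(3.5)] [cite: Dodson1987, Thm. 1.0 and Thm. 1.4] -/
theorem exists_exceptional_iff_finrank_traceField_eq_eight_of_cmTypeRank_eq_four (Φ : CMType K)
    (hr : cmTypeRank Φ = 4) (hA : IsCMTypeRealisation Φ A ι θ) :
    (∃ m : ℕ, ∃ c : complexBetti A.X (2 * m), IsRationalClass c ∧
        IsOfHodgeType (finrank ℚ K / 2) A.X (2 * m) m m c ∧ c ∉ divisorClassesSpan A.X (finrank ℚ K / 2) m) ↔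
      finrank ℚ (traceField Φ) = 8 := by
  rw [exists_exceptional_iff_lt_finrank_traceField Φ hA, hr]
  rcases finrank_traceField_eq_six_or_eight_of_cmTypeRank_eq_four Φ hr with h | h <;> rw [h] <;> norm_num

/-- **Rank `4`, `[K* : ℚ] = 6`, abelian `K` ⟹ the Hodge conjecture for every power `Aⁿ`.**
[cite: Gordon1999HodgeAVSurvey, Thm. 6.4 and §9.3] [cite: Ribet1980, §3 (3.4)–(3.5)] -/
theorem hodgeConjectureFor_pow_of_cmTypeRank_eq_four_of_finrank_traceField_eq_six (Φ : CMType K)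
    (hr : cmTypeRank Φ = 4) (h6 : finrank ℚ (traceField Φ) = 6) (hA : IsCMTypeRealisation Φ A ι θ) (n : ℕ) :
    HodgeConjectureFor (⨁ fun _ : Fin n => A).dim (⨁ fun _ : Fin n => A).X :=
  hodgeConjectureFor_pow_of_finrank_traceField_eq Φ (by rw [h6, hr]) hA n

/-- **Rank `5`, abelian `K`: `Bᵐ(A) ⊗ ℂ = Dᵐ(A) ⊗ ℂ` for all `m` iff `[K* : ℚ] = 8`.** [cite: Gordon1999HodgeAVSurvey, Thm. 6.4 and §9.2]
[cite: Ribet1980, §3 (3.4)–(3.5)] [cite: Dodson1987, Thm. 1.0] -/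
theorem forall_hodgeClassSpan_eq_iff_finrank_traceField_eq_eight_of_cmTypeRank_eq_five (Φ : CMType K)
    (hr : cmTypeRank Φ = 5) (hA : IsCMTypeRealisation Φ A ι θ) :
    (∀ m : ℕ, hodgeClassSpan (finrank ℚ K / 2) A.X m = divisorClassesSpan A.X (finrank ℚ K / 2) m) ↔
      finrank ℚ (traceField Φ) = 8 := by
  rw [forall_hodgeClassSpan_eq_iff_finrank_traceField_eq Φ hA, hr]

/-- **RANK `5`, ABELIAN `K`: `A` CARRIES AN EXCEPTIONAL HODGE CLASS IFF `[K* : ℚ] ∈ {12, 16}`** (the remaining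
possibility `[K* : ℚ] = 8` carrying none on any power). [cite: Gordon1999HodgeAVSurvey, Thm. 6.4 and §9.2]
[cite: White1993SporadicCycles, §4 Theorem 3] [cite: Ribet1980, §3 (3.4)–(3.5)] [cite: Dodson1987, Thm. 1.0, Thm. 1.4 and Thm. 1.12] -/
theorem exists_exceptional_iff_finrank_traceField_mem_of_cmTypeRank_eq_five (Φ : CMType K)
    (hr : cmTypeRank Φ = 5) (hA : IsCMTypeRealisation Φ A ι θ) :
    (∃ m : ℕ, ∃ c : complexBetti A.X (2 * m), IsRationalClass c ∧
        IsOfHodgeType (finrank ℚ K / 2) A.X (2 * m) m m c ∧ c ∉ divisorClassesSpan A.X (finrank ℚ K / 2) m) ↔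
      finrank ℚ (traceField Φ) = 12 ∨ finrank ℚ (traceField Φ) = 16 := by
  rw [exists_exceptional_iff_lt_finrank_traceField Φ hA, hr]
  rcases finrank_traceField_mem_of_cmTypeRank_eq_five Φ hr with h | h | h <;> rw [h] <;> norm_num

/-- **Rank `5`, `[K* : ℚ] = 8`, abelian `K` ⟹ the Hodge conjecture for every power `Aⁿ`** (e.g. the rank-`5` types of
multiquadratic fields, tree `MultiquadraticCMFieldRankFiveTypesHodgeConjecture`). [cite: Gordon1999HodgeAVSurvey, Thm. 6.4 and §9.3]
[cite: Ribet1980, §3 (3.4)–(3.5)] -/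
theorem hodgeConjectureFor_pow_of_cmTypeRank_eq_five_of_finrank_traceField_eq_eight (Φ : CMType K)
    (hr : cmTypeRank Φ = 5) (h8 : finrank ℚ (traceField Φ) = 8) (hA : IsCMTypeRealisation Φ A ι θ) (n : ℕ) :
    HodgeConjectureFor (⨁ fun _ : Fin n => A).dim (⨁ fun _ : Fin n => A).X :=
  hodgeConjectureFor_pow_of_finrank_traceField_eq Φ (by rw [h8, hr]) hA n

end RankFourFive

/-! ## §4 Abelian `K`, by reflex degree: `6` is harmless, `8` is exceptional exactly in rank `4` -/

section ReflexDegree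

variable [IsAbelianGalois ℚ K]

/-- **`[K* : ℚ] = 6`, abelian `K` ⟹ THE HODGE CONJECTURE FOR EVERY POWER `Aⁿ`** (then `Rank(Φ) = 4 = 6/2 + 1`, the
extremal case).  Not so for non-abelian `K`: the degenerate octic types of Mumford–Pohlmann have sextic reflex fields.
[cite: Gordon1999HodgeAVSurvey, Thm. 6.4 and §9.3] [cite: Ribet1980, §3 (3.4)–(3.5)] [cite: Dodson1987, Thm. 1.0 and Thm. 1.4] -/
theorem hodgeConjectureFor_pow_of_finrank_traceField_eq_six (Φ : CMType K) (h6 : finrank ℚ (traceField Φ) = 6)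
    (hA : IsCMTypeRealisation Φ A ι θ) (n : ℕ) :
    HodgeConjectureFor (⨁ fun _ : Fin n => A).dim (⨁ fun _ : Fin n => A).X :=
  hodgeConjectureFor_pow_of_finrank_traceField_eq Φ
    (by rw [h6, cmTypeRank_eq_four_of_finrank_traceField_eq_six Φ h6]) hA n

/-- **`[K* : ℚ] = 8`, ABELIAN `K`: `A` CARRIES AN EXCEPTIONAL HODGE CLASS IFF `Rank(Φ) = 4`** (the rank is `4` or `5`;
rank `5 = 8/2 + 1` is the extremal, harmless case). [cite: Gordon1999HodgeAVSurvey, Thm. 6.4 and §9.2]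
[cite: White1993SporadicCycles, §4 Theorem 3] [cite: Ribet1980, §3 (3.4)–(3.5)] [cite: Pohlmann1968, Thm. 1 and §3] -/
theorem exists_exceptional_iff_cmTypeRank_eq_four_of_finrank_traceField_eq_eight (Φ : CMType K)
    (h8 : finrank ℚ (traceField Φ) = 8) (hA : IsCMTypeRealisation Φ A ι θ) :
    (∃ m : ℕ, ∃ c : complexBetti A.X (2 * m), IsRationalClass c ∧
        IsOfHodgeType (finrank ℚ K / 2) A.X (2 * m) m m c ∧ c ∉ divisorClassesSpan A.X (finrank ℚ K / 2) m) ↔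
      cmTypeRank Φ = 4 := by
  rw [exists_exceptional_iff_lt_finrank_traceField Φ hA, h8]
  rcases cmTypeRank_mem_of_finrank_traceField_eq_eight Φ h8 with h | h <;> rw [h] <;> norm_num

/-- **`[K* : ℚ] = 8`, abelian `K`: `Bᵐ(A) ⊗ ℂ = Dᵐ(A) ⊗ ℂ` for all `m` iff `Rank(Φ) = 5`.** [cite: Gordon1999HodgeAVSurvey, Thm. 6.4 and §9.2]
[cite: Ribet1980, §3 (3.4)–(3.5)] -/
theorem forall_hodgeClassSpan_eq_iff_cmTypeRank_eq_five_of_finrank_traceField_eq_eight (Φ : CMType K)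
    (h8 : finrank ℚ (traceField Φ) = 8) (hA : IsCMTypeRealisation Φ A ι θ) :
    (∀ m : ℕ, hodgeClassSpan (finrank ℚ K / 2) A.X m = divisorClassesSpan A.X (finrank ℚ K / 2) m) ↔
      cmTypeRank Φ = 5 := by
  rw [forall_hodgeClassSpan_eq_iff_finrank_traceField_eq Φ hA, h8]
  rcases cmTypeRank_mem_of_finrank_traceField_eq_eight Φ h8 with h | h <;> rw [h] <;> norm_num

/-- **`[K* : ℚ] = 8` and `Rank(Φ) = 5`, abelian `K` ⟹ the Hodge conjecture for every power `Aⁿ`.**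
[cite: Gordon1999HodgeAVSurvey, Thm. 6.4 and §9.3] [cite: Ribet1980, §3 (3.4)–(3.5)] -/
theorem hodgeConjectureFor_pow_of_finrank_traceField_eq_eight_of_cmTypeRank_eq_five (Φ : CMType K)
    (h8 : finrank ℚ (traceField Φ) = 8) (hr : cmTypeRank Φ = 5) (hA : IsCMTypeRealisation Φ A ι θ) (n : ℕ) :
    HodgeConjectureFor (⨁ fun _ : Fin n => A).dim (⨁ fun _ : Fin n => A).X :=
  hodgeConjectureFor_pow_of_finrank_traceField_eq Φ (by rw [h8, hr]) hA n

end ReflexDegree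

end Literature.AlgebraicGeometry.Pohlmann1968
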